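import Literature.MathematicalPhysics.QuantumFieldTheory.Balaban1983to89.B9Eq311L2Pairing
import Mathlib.Analysis.SpecialFunctions.Exponential

/-!
# `Balaban1983to89.B9Eq3101ExpPointwiseMultiplier` — T. Bałaban, *Propagators for lattice gauge theories in a background field*, Commun. Math. Phys. **99**
# (1985) 389–434 [Balaban1985BackgroundPropagators] (3.49) p. 399 with (3.101)–(3.103) p. 414: **THE COMBES–THOMAS DRESSING `e^{κχ}` AS THE OPERATOR
# EXPONENTIAL OF THE CUTOFF MULTIPLIER** — on the NE9 chain's weighted `L²` carriers `WL2 𝕜 w V`, for a continuous linear map `M` ACTING POINTWISE as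
# the multiplication by a scalar symbol `σ` (`(Mf)(x) = σ(x)·f(x)`): `(Mⁿf)(x) = σ(x)ⁿ·f(x)` and **`(exp(κ•M)f)(x) = exp(κσ(x))·f(x)`** — the identification
# between the dressing family `exp(κ•χ_E) ∘ T ∘ exp(κ•(−χ_S))` of NE9 leaf-01's (A)-glue `B9Eq3101CommutatorCauchyBlockDecay` (CLM exponentials, Cauchy's
# estimate on a circle `‖κ‖ = r`) and the POINTWISE-hypothesised multipliers `S`, `S_B`, `S_G` (`(Sf)(x) = e^{κχ(x)}f(x)`) of NE9 leaf-06's S-P5(b) END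
# `B9Eq349ConjugatedDPChain(Section)` — route R2′ STEP B8′, the junction S-P5(b) → S-P7 (instance-ledger row L9's `k_W`)

statement-level skeleton of published theorems with citation tags; proofs where landed; nothing here is a claim about the Yang–Mills mass gap

CITATION HEADER (lean-in-tree rule).  Audit cell `pub-balaban`, sub-cell `t4`, BINDER row NE9; filed by NE9 formalisation-swarm LEAF PROVER 01
(`b2b-balaban-t4-ne9-formalise-leaf-01`, gen 82), author lineage of (A) `B9Eq3101CommutatorCauchyBlockDecay` ∕ (B) `B9Eq3101DoubleCommutatorBlockSchur` (gen 80);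
NE9 leaf-06 gen 66's close (journal 2026-08-23 l.50247) names «the circle form `‖κ‖ = r`, `β := max(s_D, s_{Q′})·r` for leaf-01's (A) Cauchy extraction» as
open — THIS is its first brick.  Source READ in the held text `paper:balaban1985-cmp99-background-propagators` (journal page = PDF page + 388): p. 399 (3.49),
p. 414 (3.101)–(3.103); the conjugation is the route's Combes–Thomas substitute for print's random-walk expansion (J.-M. Combes, L. Thomas, Commun. Math.
Phys. **34** (1973) 251–270, context only).

THE PRINT (verbatim, p. 399).  *«For the operator P = I − R we obtain, using again Lemma 2.1, [|P(x, x′)|, |(DP)_μ(x, x′)|, …] ≤ O(1)[…]e^{−δ₀d(y,y′)} (3.49)»*;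
p. 414 l. 1–3: the commutators with `h` *«are first order differential operators … of the order O(M⁻¹), or O(M⁻²), if considered on a proper scale.»*  Nothing
of (3.49) is asserted; the exponential weight `e^{κχ}` is the device by which the route derives commutator bounds from conjugation bounds.

WHAT IS PROVED (sorry-free; proof lane — no `def`; [folklore] power series of the exponential in a complete normed algebra, mapped through the evaluation CLM).
Setting: `RCLike 𝕜`, a finite index type `X` with positive weights, a finite-dimensional inner-product fibre `V` (so the operator algebra of `WL2 𝕜 w V` is
complete), a CLM `M` with `(Mf)(x) = σ(x)·f(x)` for a scalar symbol `σ : X → 𝕜` (hypothesis `hM` — the pointwise dress of `B9Eq311PointwiseMultipliers`).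
* `equiv_pow_apply` — `(Mⁿf)(x) = σ(x)ⁿ·f(x)`.
* **`equiv_exp_smul_apply`** — `(exp(κ•M)f)(x) = exp(κσ(x))·f(x)` for every `κ : 𝕜` (`NormedSpace.exp`; the series `Σ (n!)⁻¹(κ•M)ⁿ` mapped through
  `T ↦ (Tf)(x)` by `HasSum.mapL`, then `(n!)⁻¹(κσ(x))ⁿ` summed by `exp_series_hasSum_exp'` and uniqueness of limits).
* `equiv_exp_smul_apply_real` — the same for a REAL symbol `χ` read in `𝕜` (the cutoffs of the chain): `(exp(κ•M_χ)f)(x) = exp(κχ(x))·f(x)`;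
  **`equiv_exp_smul_apply_complex`** ∕ **`equiv_exp_smul_neg_apply_complex`** — at `𝕜 = ℂ` with `Complex.exp` (`Complex.exp_eq_exp_ℂ`): LITERALLY leaf-06's
  `hS`∕`hSB`∕`hSG` (for `exp(κ•M_χ)`) and `hSinv`∕`hSBinv`∕`hSGinv` (for `exp(κ•(−M_χ))`) shapes.
CONSEQUENCE (words): with `M_χ` the multiplier CLM of a real cutoff on each carrier ((D) `B9Eq387IMSLocalLettersLattice.exists_pointwise_clm`), the (A)-glue's
family `κ ↦ exp(κ•M_χ^E) ∘ T ∘ exp(κ•(−M_χ^S))` satisfies leaf-06's hypotheses `hS`∕`hSinv`∕`hSB`∕… VERBATIM at every `κ`, so the S-P5(b) END's bound on the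
dressed `DP` is a circle bound in the sense of `norm_comm_le_of_circle_bound` ∕ `norm_comm_comm_le_of_circle_bound`.
HONEST SCOPE.  One identification lemma; no commutator, no decay, no number; NOT the `k_W` extraction itself (the sequel composes it); NOT NE9 (cell pub-balaban:
NE9 NOT PRINTED ∕ NOT PROVED; «NE9 ⇐ the named binders»; row WALLED ON A MODEL (O-NE9-1); spine PROVED 0∕9; rung (B)+1 on a finite T⁴ — NOT infinite volume,
NOT mass gap, NOT Clay; HONEST DEPENDENCY: continuum YM on T⁴ ⇐ BetaPertH ∧ nine spine estimates (0/9 proved); BetaPertH ⇐ (D1) ∧ (D4) ∧ CAP+tail; G-an2-4 gates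
asym, D1 and NE2/3/4).  NEW file importing `B9Eq311L2Pairing` and `Mathlib.Analysis.SpecialFunctions.Exponential` only; nothing modified.  Net new unproved facts: 0.
-/

noncomputable section

open scoped BigOperators InnerProductSpace
open NormedSpace

namespace Literature.MathematicalPhysics.QuantumFieldTheory.Balaban1983to89.B9Eq3101ExpPointwiseMultiplier

open B9Eq311L2Pairing (WL2)

variable {𝕜 : Type*} [RCLike 𝕜] {X : Type*} [Fintype X] {w : X → ℝ} [Fact (∀ x, 0 < w x)]
  {V : Type*} [NormedAddCommGroup V] [InnerProductSpace 𝕜 V]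

/-- **POWERS OF A POINTWISE MULTIPLIER** act pointwise by the powers of the symbol: `(Mⁿf)(x) = σ(x)ⁿ·f(x)`. [folklore]
[cite: Balaban1985BackgroundPropagators, (3.49) p.399, (3.101) p.414] -/
theorem equiv_pow_apply (M : WL2 𝕜 w V →L[𝕜] WL2 𝕜 w V) (σ : X → 𝕜)
    (hM : ∀ (f : WL2 𝕜 w V) (x : X), WL2.equiv 𝕜 w V (M f) x = σ x • WL2.equiv 𝕜 w V f x) (n : ℕ) (f : WL2 𝕜 w V) (x : X) :
    WL2.equiv 𝕜 w V ((M ^ n) f) x = σ x ^ n • WL2.equiv 𝕜 w V f x := by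
  induction n generalizing f with
  | zero => simp
  | succ n ih => rw [pow_succ, ContinuousLinearMap.mul_def, ContinuousLinearMap.comp_apply, ih (M f), hM, smul_smul, pow_succ]

variable [FiniteDimensional 𝕜 V]

/-- **THE EXPONENTIAL OF A POINTWISE MULTIPLIER ACTS POINTWISE BY THE EXPONENTIAL OF THE SYMBOL**: `(exp(κ•M)f)(x) = exp(κσ(x))·f(x)` — the operator
exponential `NormedSpace.exp` in the complete normed algebra of CLMs of the carrier, every `κ : 𝕜`. [folklore] (power series mapped through the evaluation CLM)
[cite: Balaban1985BackgroundPropagators, (3.49) p.399, (3.101)–(3.103) p.414] -/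
theorem equiv_exp_smul_apply (M : WL2 𝕜 w V →L[𝕜] WL2 𝕜 w V) (σ : X → 𝕜)
    (hM : ∀ (f : WL2 𝕜 w V) (x : X), WL2.equiv 𝕜 w V (M f) x = σ x • WL2.equiv 𝕜 w V f x) (κ : 𝕜) (f : WL2 𝕜 w V) (x : X) :
    WL2.equiv 𝕜 w V (exp (κ • M) f) x = exp (κ * σ x) • WL2.equiv 𝕜 w V f x := by
  -- evaluation at `f` then at `x`, as a continuous linear map on the operator algebra
  let evx : WL2 𝕜 w V →L[𝕜] V :=
    LinearMap.toContinuousLinearMap ((LinearMap.proj x).comp (WL2.linearEquiv 𝕜 𝕜 w (V := V)).toLinearMap)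
  let ev : (WL2 𝕜 w V →L[𝕜] WL2 𝕜 w V) →L[𝕜] V := evx ∘L ContinuousLinearMap.apply 𝕜 (WL2 𝕜 w V) f
  have hev : ∀ T : WL2 𝕜 w V →L[𝕜] WL2 𝕜 w V, ev T = WL2.equiv 𝕜 w V (T f) x := fun T => rfl
  -- the exponential series mapped through `ev`
  have h1 := (exp_series_hasSum_exp' (𝕂 := 𝕜) (κ • M)).mapL ev
  have hκM : ∀ (g : WL2 𝕜 w V) (y : X), WL2.equiv 𝕜 w V ((κ • M) g) y = (κ * σ y) • WL2.equiv 𝕜 w V g y := fun g y => by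
    rw [smul_apply, WL2.equiv_smul, Pi.smul_apply, hM, smul_smul]
  have h2 : (fun n : ℕ => ev ((n.factorial⁻¹ : 𝕜) • (κ • M) ^ n)) =
      fun n : ℕ => ((n.factorial⁻¹ : 𝕜) * (κ * σ x) ^ n) • WL2.equiv 𝕜 w V f x := by
    funext n
    rw [hev, smul_apply, WL2.equiv_smul, Pi.smul_apply, equiv_pow_apply (κ • M) (fun y => κ * σ y) hκM n f x, smul_smul]
  rw [h2, hev] at h1
  have h3 : HasSum (fun n : ℕ => ((n.factorial⁻¹ : 𝕜) * (κ * σ x) ^ n) • WL2.equiv 𝕜 w V f x) (exp (κ * σ x) • WL2.equiv 𝕜 w V f x) := by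
    have h := (exp_series_hasSum_exp' (𝕂 := 𝕜) (κ * σ x)).smul_const (WL2.equiv 𝕜 w V f x)
    simpa only [smul_eq_mul] using h
  exact h1.unique h3

/-- **… FOR A REAL CUTOFF** `χ : X → ℝ` read in `𝕜` (the chain's dress `(M_χf)(x) = (χ(x) : 𝕜)·f(x)`, (D)∕leaf-04∕leaf-05's `hS`∕`hE` shape):
`(exp(κ•M_χ)f)(x) = exp(κ·χ(x))·f(x)` — leaf-06's pointwise hypothesis `hS` for `S := exp(κ•M_χ)`, at EVERY `κ`. [folklore]
[cite: Balaban1985BackgroundPropagators, (3.49) p.399, (3.101)–(3.103) p.414] -/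
theorem equiv_exp_smul_apply_real (M : WL2 𝕜 w V →L[𝕜] WL2 𝕜 w V) (χ : X → ℝ)
    (hM : ∀ (f : WL2 𝕜 w V) (x : X), WL2.equiv 𝕜 w V (M f) x = (χ x : 𝕜) • WL2.equiv 𝕜 w V f x) (κ : 𝕜) (f : WL2 𝕜 w V) (x : X) :
    WL2.equiv 𝕜 w V (exp (κ • M) f) x = exp (κ * (χ x : 𝕜)) • WL2.equiv 𝕜 w V f x :=
  equiv_exp_smul_apply M (fun x => (χ x : 𝕜)) hM κ f x

/-- **… AT THE CHAIN (`𝕜 = ℂ`, `Complex.exp`)**: `(exp(κ•M_χ)f)(x) = Complex.exp(κ·χ(x))·f(x)` — LITERALLY the hypothesis shape `hS` ∕ `hSB` ∕ `hSG` of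
NE9 leaf-06's `B9Eq349ConjugatedDPChain(Section)` for `S := exp(κ•M_χ)` (and `hSinv` ∕ … for `exp(κ•(−M_χ))` through the symbol `−χ`), at EVERY `κ`. [folklore]
[cite: Balaban1985BackgroundPropagators, (3.49) p.399, (3.101)–(3.103) p.414] -/
theorem equiv_exp_smul_apply_complex {X : Type*} [Fintype X] {w : X → ℝ} [Fact (∀ x, 0 < w x)]
    {V : Type*} [NormedAddCommGroup V] [InnerProductSpace ℂ V] [FiniteDimensional ℂ V]
    (M : WL2 ℂ w V →L[ℂ] WL2 ℂ w V) (χ : X → ℝ)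
    (hM : ∀ (f : WL2 ℂ w V) (x : X), WL2.equiv ℂ w V (M f) x = (χ x : ℂ) • WL2.equiv ℂ w V f x) (κ : ℂ) (f : WL2 ℂ w V) (x : X) :
    WL2.equiv ℂ w V (exp (κ • M) f) x = Complex.exp (κ * (χ x : ℂ)) • WL2.equiv ℂ w V f x := by
  rw [Complex.exp_eq_exp_ℂ]; exact equiv_exp_smul_apply_real M χ hM κ f x

/-- The inverse dressing: `(exp(κ•(−M_χ))f)(x) = Complex.exp(−(κ·χ(x)))·f(x)` — leaf-06's `hSinv` ∕ `hSBinv` ∕ `hSGinv` shape. [folklore]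
[cite: Balaban1985BackgroundPropagators, (3.49) p.399, (3.101)–(3.103) p.414] -/
theorem equiv_exp_smul_neg_apply_complex {X : Type*} [Fintype X] {w : X → ℝ} [Fact (∀ x, 0 < w x)]
    {V : Type*} [NormedAddCommGroup V] [InnerProductSpace ℂ V] [FiniteDimensional ℂ V]
    (M : WL2 ℂ w V →L[ℂ] WL2 ℂ w V) (χ : X → ℝ)
    (hM : ∀ (f : WL2 ℂ w V) (x : X), WL2.equiv ℂ w V (M f) x = (χ x : ℂ) • WL2.equiv ℂ w V f x) (κ : ℂ) (f : WL2 ℂ w V) (x : X) :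
    WL2.equiv ℂ w V (exp (κ • (-M)) f) x = Complex.exp (-(κ * (χ x : ℂ))) • WL2.equiv ℂ w V f x := by
  have hM' : ∀ (f : WL2 ℂ w V) (x : X), WL2.equiv ℂ w V ((-M) f) x = (-(χ x : ℂ)) • WL2.equiv ℂ w V f x := fun f x => by
    have h0 : WL2.equiv ℂ w V ((-M) f) x = -(WL2.equiv ℂ w V (M f) x) := rfl
    rw [h0, hM, neg_smul]
  rw [Complex.exp_eq_exp_ℂ, ← mul_neg]
  exact equiv_exp_smul_apply (-M) (fun x => -(χ x : ℂ)) hM' κ f x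

/-- Non-vacuity: the zero multiplier (`σ = 0`) gives `exp(κ•0) = 1` pointwise. [folklore] [cite: Balaban1985BackgroundPropagators, (3.49) p.399] -/
example (κ : 𝕜) (f : WL2 𝕜 w V) (x : X) : WL2.equiv 𝕜 w V (exp (κ • (0 : WL2 𝕜 w V →L[𝕜] WL2 𝕜 w V)) f) x = exp (κ * 0) • WL2.equiv 𝕜 w V f x :=
  equiv_exp_smul_apply 0 (fun _ => 0) (fun f x => by simp) κ f x

end Literature.MathematicalPhysics.QuantumFieldTheory.Balaban1983to89.B9Eq3101ExpPointwiseMultiplier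

end
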